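import Summits.BirchSwinnertonDyer.Rank1Residual.Additive.X3BranchResidualCountOfCharacterFacts
import Summits.BirchSwinnertonDyer.BirchSwinnertonDyer.Theorems.EisensteinPrimesLineCharactersAtMultiplicativePlace
import Summits.BirchSwinnertonDyer.BirchSwinnertonDyer.Theorems.EisensteinPrimesResidualLineRigidity
import Summits.BirchSwinnertonDyer.BirchSwinnertonDyer.Theorems.EisensteinPrimesMazurMCOnCellBTwistbackTwistLineCharacters
import Literature.NumberTheory.GaloisRepresentations.ImaginaryQuadraticCyclotomicProofs
import Literature.NumberTheory.GaloisRepresentations.DirichletCharacterOfGaloisCharacter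
import HarnessLib

/-!
# Crux 3 `MazurMCOnCellB` (stmt-BirchSwinnertonDyer-19033), line `twistback` v4 — the WEIL RELATION of a rational
# line in Dirichlet form (`φ(a)·ā⁻¹ = ψ⁻¹(a)` for every `a` prime to `p`), its conductor-support corollary, and the
# parities of the two characters — DISCHARGING the per-pair binder `hφψ` of the KL-flat doors (p645771 §1–§3,
# p650639 §1–§2) for EVERY curve

LEAD bsd-line-x2-p1 g11 (2026-08-28). HONEST FRAMING (cell `bsd-eis`, run/shared/lean/pub/bsd-eis/): Galois-module /
Dirichlet-character algebra only; THEOREMS ONLY (no `def`, no named fact, no `sorry`); `--supports`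
stmt-BirchSwinnertonDyer-19033; closes no stub by itself; no summit statement, no Mazur main conjecture and no BSD is
proved for any curve; 0 cells / labels / tiers move.

WHY. The KL-flat partner doors of LEAD g10 (`…TwistbackKLFlatPartnerUnits`, p645771) and of width seat w7
(`…KLFlatPartnerUnitsPsi`, p650639) carry, for the carrier `V′` of the twist with its ramified-even line `Φ₀` and
primitive characters `φ` (mod `m`) on `Φ₀`, `ψ` (mod `d`) on `V′[p]/Φ₀`, the binder
`hφψ : ∀ a : ℕ, ¬ p ∣ a → φ a · ā⁻¹ = ψ⁻¹ a` — Greenberg–Vatsal's "`φψ = ω`" (p. 28) read as an identity of functions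
on the integers prime to `p`. The tree has the Weil-pairing identity per Galois element
(`X3Branch.natCast_mul_eq_modNCyclotomicCharacter_of_line`: `σ` acts on `Φ₀` by `a`, on the quotient by `b` ⟹
`a·b = χ_p(σ)`), but not the function form, which needs two more facts: `χ_N : Γ_ℚ → (ℤ/N)ˣ` is onto
(`Rat.modNCyclotomicCharacter_surjective`), and the SUPPORTS of `m` and `d` away from `p` coincide (so that both
sides vanish together at the integers not prime to `m`). This file proves the function form for EVERY elliptic curve
over `ℚ`, every prime `p` and every rational line with primitive characters — so the sub-row assembly of the LEAD
(`…TwistbackSubrowCarrier`) can feed the doors with the twisted characters `φχ̄_K`, `ψχ̄_K` of w3 g8's dictionary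
without any per-pair input.

* §1 `dvd_of_isPrimitive_of_forall_coprime` (curve-free): a PRIMITIVE character `ψ` mod `d` that agrees with some
  character `θ` mod `n` at every integer prime to `d·n` has `d ∣ n` (both lift to the same character mod `d·n`;
  Mathlib's `conductor_changeLevel`).
* §2 `apply_mul_apply_eq_natCast_of_line` — `φ(b)·ψ(b) = b̄` for `b` prime to `m·d·p`;
  `level_dvd_of_line` — `m ∣ d·p` and `d ∣ m·p` (conductor support: the primes `≠ p` of `m` and of `d` coincide);
  **`weilRelation_of_line`** — `∀ a, ¬ p ∣ a → φ(a)·ā⁻¹ = ψ⁻¹(a)` (THE binder `hφψ`).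
* §3 parities: `even_of_lineEven` / `odd_of_lineOdd` (the line character), `odd_quot_of_lineEven` /
  `even_quot_of_lineOdd` (the quotient character; `φ(−1)ψ(−1) = χ_p(c) = −1` at a complex conjugation `c`).
* §4 `isQuadratic_changeLevel_mul_changeLevel` (curve-free): a product of quadratic-valued characters read at the
  product level is quadratic-valued (for w3 g7's class-number form of the Bernoulli unit at the twisted character).

References: [GreenbergVatsal2000] §2 p. 28 ("`φψ = ω`"); [Washington1997] Thm. 2.5 (`Gal(ℚ(ζ_N)/ℚ) ≃ (ℤ/N)ˣ`),
Ch. 3 (conductors; `χ(−1) = χ(c)`, p. 19); [SilvermanAEC2009] III.8 (Weil pairing, `det ρ̄ = χ_p`).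
-/

set_option autoImplicit false

-- `Summit.BirchSwinnertonDyer.BirchSwinnertonDyer.…`: the summit and its single sub-problem share a name.
set_option linter.dupNamespace false

noncomputable section

open scoped Classical

open WeierstrassCurve NumberField IsDedekindDomain Field DirichletCharacter
  Literature.NumberTheory.EllipticCurves Literature.NumberTheory.GaloisRepresentations
  Literature.NumberTheory.EllipticCurves.Rank1Residual
  Summit.BirchSwinnertonDyer.Rank1Residual.Additive
  Summit.BirchSwinnertonDyer.BirchSwinnertonDyer.Theorems.EisensteinPrimesLineCharactersAtMultiplicativePlace
  Summit.BirchSwinnertonDyer.BirchSwinnertonDyer.Theorems.EisensteinPrimesMazurMCOnCellBTwistbackTwistLineCharacters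

namespace Summit.BirchSwinnertonDyer.BirchSwinnertonDyer.Theorems.EisensteinPrimesLineWeilRelation

/-! ## §1. A primitive character agreeing with a character of another level off the levels -/

/-- **Conductor support from agreement off the level** (curve-free): if `ψ` is a PRIMITIVE Dirichlet character
modulo `d` and `θ` is any Dirichlet character modulo `n` with `ψ(b) = θ(b)` for every natural number `b` prime to
`d·n`, then `d ∣ n` — both lift to the SAME character modulo `d·n` (a Dirichlet character is determined by its values
on units), whose conductor is `d` (Mathlib `conductor_changeLevel`) and divides `n` (`conductor_dvd_level`).
[cite: Washington1997, Ch. 3 (conductor of a Dirichlet character; induced characters)] -/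
theorem dvd_of_isPrimitive_of_forall_coprime {R : Type*} [CommMonoidWithZero R] {d n : ℕ} [NeZero d] [NeZero n]
    {ψ : DirichletCharacter R d} (hψ : ψ.IsPrimitive) (θ : DirichletCharacter R n)
    (h : ∀ b : ℕ, b.Coprime (d * n) → ψ (b : ZMod d) = θ (b : ZMod n)) : d ∣ n := by
  have heq : changeLevel (dvd_mul_right d n) ψ = changeLevel (dvd_mul_left n d) θ := by
    refine MulChar.ext fun u ↦ ?_
    have hb : (((u : ZMod (d * n)).val : ℕ) : ZMod (d * n)) = (u : ZMod (d * n)) := ZMod.natCast_zmod_val _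
    rw [changeLevel_eq_cast_of_dvd, changeLevel_eq_cast_of_dvd, ← hb, ZMod.cast_natCast (dvd_mul_right d n),
      ZMod.cast_natCast (dvd_mul_left n d)]
    exact h _ (ZMod.val_coe_unit_coprime u)
  have h1 : (changeLevel (dvd_mul_right d n) ψ).conductor = d := by
    rw [conductor_changeLevel]; exact hψ
  have h2 : (changeLevel (dvd_mul_left n d) θ).conductor ∣ n := by
    rw [conductor_changeLevel]; exact conductor_dvd_level θ
  rw [heq] at h1
  rwa [h1] at h2

/-! ## §2. The Weil relation `φψ = ω` of a rational line, in Dirichlet form -/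

section Weil

variable {W : WeierstrassCurve ℚ} [W.IsElliptic] {p : ℕ} [hp : Fact p.Prime]
  {Φ₀ : AddSubgroup (geomTorsion W (p : ℤ))}
  {m : ℕ} [NeZero m] {φ : DirichletCharacter (ZMod p) m} {d : ℕ} [NeZero d] {ψ : DirichletCharacter (ZMod p) d}

/-- **`φ(b)·ψ(b) = b̄` in `𝔽_p` for every `b` prime to `m·d·p`** — the Weil pairing `φψ = χ_p` on `W[p]`
(`X3Branch.natCast_mul_eq_modNCyclotomicCharacter_of_line`) read at a Galois element `σ` with `χ_{mdp}(σ) = b̄`, which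
exists because `χ_N : Γ_ℚ → (ℤ/N)ˣ` is onto (`Rat.modNCyclotomicCharacter_surjective`), and `χ_{mdp} ≡ χ_m, χ_d, χ_p`
modulo `m`, `d`, `p` (`cast_modNCyclotomicCharacter`). No primitivity needed. [cite: GreenbergVatsal2000, §2 p. 28]
[cite: Washington1997, Thm. 2.5] [cite: SilvermanAEC2009, III.8 Prop. 8.1] -/
theorem apply_mul_apply_eq_natCast_of_line (hΦ : IsRationalLine W p Φ₀)
    (hφ0 : ∀ (σ : absoluteGaloisGroup ℚ), ∀ P ∈ Φ₀,
      σ • P = (φ ((modNCyclotomicCharacter ℚ m σ : (ZMod m)ˣ) : ZMod m)).val • P)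
    (hψ0 : ∀ (σ : absoluteGaloisGroup ℚ) (P : geomTorsion W (p : ℤ)),
      σ • P - (ψ ((modNCyclotomicCharacter ℚ d σ : (ZMod d)ˣ) : ZMod d)).val • P ∈ Φ₀)
    {b : ℕ} (hb : b.Coprime (m * d * p)) :
    φ (b : ZMod m) * ψ (b : ZMod d) = (b : ZMod p) := by
  haveI : NeZero p := ⟨hp.out.ne_zero⟩
  haveI : NeZero (m * d * p) := ⟨by simp [NeZero.ne m, NeZero.ne d, NeZero.ne p]⟩
  haveI : NeZero ((m * d * p : ℕ) : ℚ) := ⟨by exact_mod_cast NeZero.ne (m * d * p)⟩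
  obtain ⟨σ, hσ⟩ := Rat.modNCyclotomicCharacter_surjective (m * d * p) (ZMod.unitOfCoprime b hb)
  have hM : ((modNCyclotomicCharacter ℚ (m * d * p) σ : (ZMod (m * d * p))ˣ) : ZMod (m * d * p)) =
      (b : ZMod (m * d * p)) := by
    rw [hσ, ZMod.coe_unitOfCoprime]
  have hm : ((modNCyclotomicCharacter ℚ m σ : (ZMod m)ˣ) : ZMod m) = (b : ZMod m) := by
    rw [← cast_modNCyclotomicCharacter ℚ (show m ∣ m * d * p from ⟨d * p, by ring⟩) σ, hM,
      ZMod.cast_natCast (show m ∣ m * d * p from ⟨d * p, by ring⟩)]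
  have hd : ((modNCyclotomicCharacter ℚ d σ : (ZMod d)ˣ) : ZMod d) = (b : ZMod d) := by
    rw [← cast_modNCyclotomicCharacter ℚ (show d ∣ m * d * p from ⟨m * p, by ring⟩) σ, hM,
      ZMod.cast_natCast (show d ∣ m * d * p from ⟨m * p, by ring⟩)]
  have hpp : ((modNCyclotomicCharacter ℚ p σ : (ZMod p)ˣ) : ZMod p) = (b : ZMod p) := by
    rw [← cast_modNCyclotomicCharacter ℚ (show p ∣ m * d * p from ⟨m * d, by ring⟩) σ, hM,
      ZMod.cast_natCast (show p ∣ m * d * p from ⟨m * d, by ring⟩)]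
  have hW := X3Branch.natCast_mul_eq_modNCyclotomicCharacter_of_line hΦ (hφ0 σ) (hψ0 σ)
  rw [ZMod.natCast_zmod_val, ZMod.natCast_zmod_val, hm, hd, hpp] at hW
  exact hW

/-- **Conductor support: the primes `≠ p` of `m` and of `d` coincide — `m ∣ d·p` and `d ∣ m·p`.** With `φψ = ω`
as functions on the integers prime to `mdp` (`apply_mul_apply_eq_natCast_of_line`), `φ` agrees off `m·(d·p)` with the
character `ψ⁻¹·ι` modulo `d·p` (`ι` = the tautological character of level `p`, `ι(u) = u`), so the PRIMITIVE `φ` has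
`m ∣ d·p` (§1); symmetrically `d ∣ m·p`. (For a curve: `ψ = ωφ⁻¹`, `ω` unramified away from `p`.)
[cite: GreenbergVatsal2000, §2 p. 28] [cite: Washington1997, Ch. 3 (conductors)] -/
theorem level_dvd_of_line (hΦ : IsRationalLine W p Φ₀) (hφ : φ.IsPrimitive) (hψ : ψ.IsPrimitive)
    (hφ0 : ∀ (σ : absoluteGaloisGroup ℚ), ∀ P ∈ Φ₀,
      σ • P = (φ ((modNCyclotomicCharacter ℚ m σ : (ZMod m)ˣ) : ZMod m)).val • P)
    (hψ0 : ∀ (σ : absoluteGaloisGroup ℚ) (P : geomTorsion W (p : ℤ)),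
      σ • P - (ψ ((modNCyclotomicCharacter ℚ d σ : (ZMod d)ˣ) : ZMod d)).val • P ∈ Φ₀) :
    m ∣ d * p ∧ d ∣ m * p := by
  haveI : NeZero p := ⟨hp.out.ne_zero⟩
  -- the tautological character `ι` of level `p` with values in `𝔽_p`
  set ι : DirichletCharacter (ZMod p) p := MulChar.ofUnitHom (MonoidHom.id (ZMod p)ˣ) with hι
  have hιb : ∀ b : ℕ, b.Coprime p → ι (b : ZMod p) = (b : ZMod p) := by
    intro b hbp
    rw [← ZMod.coe_unitOfCoprime b hbp, hι, MulChar.ofUnitHom_coe, MonoidHom.id_apply]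
  -- the values off the levels
  have hval : ∀ b : ℕ, b.Coprime (m * d * p) →
      φ (b : ZMod m) = (ψ (b : ZMod d))⁻¹ * (b : ZMod p) ∧
        ψ (b : ZMod d) = (φ (b : ZMod m))⁻¹ * (b : ZMod p) := by
    intro b hb
    have hbd : b.Coprime d := Nat.Coprime.coprime_dvd_right ⟨m * p, by ring⟩ hb
    have hbm : b.Coprime m := Nat.Coprime.coprime_dvd_right ⟨d * p, by ring⟩ hb
    have h := apply_mul_apply_eq_natCast_of_line hΦ hφ0 hψ0 hb
    have hψu : ψ (b : ZMod d) ≠ 0 := by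
      rw [← ZMod.coe_unitOfCoprime b hbd]; exact (IsUnit.map ψ (Units.isUnit _)).ne_zero
    have hφu : φ (b : ZMod m) ≠ 0 := by
      rw [← ZMod.coe_unitOfCoprime b hbm]; exact (IsUnit.map φ (Units.isUnit _)).ne_zero
    constructor
    · rw [eq_inv_mul_iff_mul_eq₀ hψu, mul_comm]; exact h
    · rw [eq_inv_mul_iff_mul_eq₀ hφu]; exact h
  constructor
  · refine dvd_of_isPrimitive_of_forall_coprime hφ
      (changeLevel (dvd_mul_right d p) ψ⁻¹ * changeLevel (dvd_mul_left p d) ι) fun b hb ↦ ?_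
    have hb' : b.Coprime (m * d * p) := by rwa [mul_assoc]
    have hbp : b.Coprime p := Nat.Coprime.coprime_dvd_right ⟨m * d, by ring⟩ hb'
    rw [changeLevel_mul_changeLevel_apply_natCast, MulChar.inv_apply_eq_inv', hιb b hbp]
    exact (hval b hb').1
  · refine dvd_of_isPrimitive_of_forall_coprime hψ
      (changeLevel (dvd_mul_right m p) φ⁻¹ * changeLevel (dvd_mul_left p m) ι) fun b hb ↦ ?_
    have hb' : b.Coprime (m * d * p) := by
      rw [show m * d * p = d * (m * p) by ring]; exact hb
    have hbp : b.Coprime p := Nat.Coprime.coprime_dvd_right ⟨m * d, by ring⟩ hb'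
    rw [changeLevel_mul_changeLevel_apply_natCast, MulChar.inv_apply_eq_inv', hιb b hbp]
    exact (hval b hb').2

/-- **The Weil relation in Dirichlet form — `∀ a, ¬ p ∣ a → φ(a)·ā⁻¹ = ψ⁻¹(a)`** (THE binder `hφψ` of the KL-flat
doors p645771 §1–§3 / p650639 §1–§2), for EVERY elliptic `W/ℚ`, prime `p`, rational line `Φ₀ ≤ W[p]` and PRIMITIVE
characters `φ` (mod `m`) on `Φ₀`, `ψ` (mod `d`) on `W[p]/Φ₀`. At `a` prime to `m` (equivalently, by
`level_dvd_of_line`, prime to `d`) this is `φ(a)ψ(a) = ā` (`apply_mul_apply_eq_natCast_of_line`); at the other `a`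
both sides vanish. [cite: GreenbergVatsal2000, §2 p. 28 ("φψ = ω")] [cite: Washington1997, Thm. 2.5 and Ch. 3] -/
theorem weilRelation_of_line (hΦ : IsRationalLine W p Φ₀) (hφ : φ.IsPrimitive) (hψ : ψ.IsPrimitive)
    (hφ0 : ∀ (σ : absoluteGaloisGroup ℚ), ∀ P ∈ Φ₀,
      σ • P = (φ ((modNCyclotomicCharacter ℚ m σ : (ZMod m)ˣ) : ZMod m)).val • P)
    (hψ0 : ∀ (σ : absoluteGaloisGroup ℚ) (P : geomTorsion W (p : ℤ)),
      σ • P - (ψ ((modNCyclotomicCharacter ℚ d σ : (ZMod d)ˣ) : ZMod d)).val • P ∈ Φ₀) :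
    ∀ a : ℕ, ¬ p ∣ a → φ (a : ZMod m) * (a : ZMod p)⁻¹ = ψ⁻¹ (a : ZMod d) := by
  haveI : NeZero p := ⟨hp.out.ne_zero⟩
  obtain ⟨hmdp, hdmp⟩ := level_dvd_of_line hΦ hφ hψ hφ0 hψ0
  intro a ha
  have hap : a.Coprime p := ((Nat.Prime.coprime_iff_not_dvd hp.out).mpr ha).symm
  by_cases ham : a.Coprime m
  · have had : a.Coprime d := Nat.Coprime.coprime_dvd_right hdmp (ham.mul_right hap)
    have hb : a.Coprime (m * d * p) := (ham.mul_right had).mul_right hap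
    have h := apply_mul_apply_eq_natCast_of_line hΦ hφ0 hψ0 hb
    have hψu : ψ (a : ZMod d) ≠ 0 := by
      rw [← ZMod.coe_unitOfCoprime a had]; exact (IsUnit.map ψ (Units.isUnit _)).ne_zero
    have ha0 : (a : ZMod p) ≠ 0 := by
      rw [Ne, ZMod.natCast_eq_zero_iff]; exact ha
    have hφa : φ (a : ZMod m) = (a : ZMod p) * (ψ (a : ZMod d))⁻¹ := by
      rw [eq_mul_inv_iff_mul_eq₀ hψu]; exact h
    rw [MulChar.inv_apply_eq_inv', hφa, mul_comm, inv_mul_cancel_left₀ ha0]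
  · have had : ¬ a.Coprime d := fun had ↦ ham (Nat.Coprime.coprime_dvd_right hmdp (had.mul_right hap))
    rw [MulChar.map_nonunit φ (fun hu ↦ ham ((ZMod.isUnit_iff_coprime a m).mp hu)), zero_mul,
      MulChar.inv_apply_eq_inv', MulChar.map_nonunit ψ (fun hu ↦ had ((ZMod.isUnit_iff_coprime a d).mp hu)),
      inv_zero]

/-! ## §3. Parities: the line character and the quotient character at a complex conjugation -/

omit [W.IsElliptic] in
/-- **An EVEN line has an even character: `φ(−1) = 1`** (a complex conjugation `c` fixes a non-zero `P ∈ Φ₀` and has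
`χ_m(c) = −1`; tree `exists_isComplexConjugation`, `modNCyclotomicCharacter_of_isComplexConjugation`).
[cite: Washington1997, Ch. 3 p. 19 ("χ(−1) = χ(c)")] [cite: GreenbergVatsal2000, Thm. (1.3) ("even")] -/
theorem even_of_lineEven (hΦ : IsRationalLine W p Φ₀) (heven : LineEven W p Φ₀)
    (hφ0 : ∀ (σ : absoluteGaloisGroup ℚ), ∀ P ∈ Φ₀,
      σ • P = (φ ((modNCyclotomicCharacter ℚ m σ : (ZMod m)ˣ) : ZMod m)).val • P) :
    φ.Even := by
  haveI : NeZero p := ⟨hp.out.ne_zero⟩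
  obtain ⟨c, hc⟩ := exists_isComplexConjugation (Rat.castHom ℝ)
  obtain ⟨P, hP, hP0⟩ := ResidualLineRigidity.exists_ne_zero_mem hΦ.1
  have h1 : c • P = (1 : ℤ) • P := by rw [one_zsmul]; exact heven c hc P hP
  have h := natCast_eq_intCast_of_smul_eq_of_ne_zero hP0 h1 (hφ0 c P hP)
  rw [ZMod.natCast_zmod_val, Int.cast_one, modNCyclotomicCharacter_of_isComplexConjugation hc] at h
  exact h

omit [W.IsElliptic] in
/-- **An ODD line has an odd character: `φ(−1) = −1`.** [cite: Washington1997, Ch. 3 p. 19] [cite: GreenbergVatsal2000, Thm. (1.3) ("odd")] -/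
theorem odd_of_lineOdd (hΦ : IsRationalLine W p Φ₀) (hodd : LineOdd W p Φ₀)
    (hφ0 : ∀ (σ : absoluteGaloisGroup ℚ), ∀ P ∈ Φ₀,
      σ • P = (φ ((modNCyclotomicCharacter ℚ m σ : (ZMod m)ˣ) : ZMod m)).val • P) :
    φ.Odd := by
  haveI : NeZero p := ⟨hp.out.ne_zero⟩
  obtain ⟨c, hc⟩ := exists_isComplexConjugation (Rat.castHom ℝ)
  obtain ⟨P, hP, hP0⟩ := ResidualLineRigidity.exists_ne_zero_mem hΦ.1
  have h1 : c • P = (-1 : ℤ) • P := by rw [neg_one_zsmul]; exact hodd c hc P hP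
  have h := natCast_eq_intCast_of_smul_eq_of_ne_zero hP0 h1 (hφ0 c P hP)
  rw [ZMod.natCast_zmod_val, Int.cast_neg, Int.cast_one, modNCyclotomicCharacter_of_isComplexConjugation hc] at h
  exact h

/-- **The quotient character of an EVEN line is odd: `ψ(−1) = −1`** (`φ(−1)ψ(−1) = χ_p(c) = −1`, Weil pairing at a
complex conjugation, and `φ(−1) = 1`). [cite: GreenbergVatsal2000, §2 p. 28 ("φψ = ω")] [cite: Washington1997, Ch. 3 p. 19] -/
theorem odd_quot_of_lineEven (hΦ : IsRationalLine W p Φ₀) (heven : LineEven W p Φ₀)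
    (hφ0 : ∀ (σ : absoluteGaloisGroup ℚ), ∀ P ∈ Φ₀,
      σ • P = (φ ((modNCyclotomicCharacter ℚ m σ : (ZMod m)ˣ) : ZMod m)).val • P)
    (hψ0 : ∀ (σ : absoluteGaloisGroup ℚ) (P : geomTorsion W (p : ℤ)),
      σ • P - (ψ ((modNCyclotomicCharacter ℚ d σ : (ZMod d)ˣ) : ZMod d)).val • P ∈ Φ₀) :
    ψ.Odd := by
  haveI : NeZero p := ⟨hp.out.ne_zero⟩
  obtain ⟨c, hc⟩ := exists_isComplexConjugation (Rat.castHom ℝ)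
  have hφ1 : φ (-1) = 1 := even_of_lineEven hΦ heven hφ0
  have hW := X3Branch.natCast_mul_eq_modNCyclotomicCharacter_of_line hΦ (hφ0 c) (hψ0 c)
  rw [ZMod.natCast_zmod_val, ZMod.natCast_zmod_val, modNCyclotomicCharacter_of_isComplexConjugation hc,
    modNCyclotomicCharacter_of_isComplexConjugation hc, modNCyclotomicCharacter_of_isComplexConjugation hc,
    hφ1, one_mul] at hW
  exact hW

/-- **The quotient character of an ODD line is even: `ψ(−1) = 1`** (`φ(−1)ψ(−1) = −1` and `φ(−1) = −1`).
[cite: GreenbergVatsal2000, §2 p. 28 ("φψ = ω")] [cite: Washington1997, Ch. 3 p. 19] -/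
theorem even_quot_of_lineOdd (hΦ : IsRationalLine W p Φ₀) (hodd : LineOdd W p Φ₀)
    (hφ0 : ∀ (σ : absoluteGaloisGroup ℚ), ∀ P ∈ Φ₀,
      σ • P = (φ ((modNCyclotomicCharacter ℚ m σ : (ZMod m)ˣ) : ZMod m)).val • P)
    (hψ0 : ∀ (σ : absoluteGaloisGroup ℚ) (P : geomTorsion W (p : ℤ)),
      σ • P - (ψ ((modNCyclotomicCharacter ℚ d σ : (ZMod d)ˣ) : ZMod d)).val • P ∈ Φ₀) :
    ψ.Even := by
  haveI : NeZero p := ⟨hp.out.ne_zero⟩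
  obtain ⟨c, hc⟩ := exists_isComplexConjugation (Rat.castHom ℝ)
  have hφ1 : φ (-1) = -1 := odd_of_lineOdd hΦ hodd hφ0
  have hW := X3Branch.natCast_mul_eq_modNCyclotomicCharacter_of_line hΦ (hφ0 c) (hψ0 c)
  rw [ZMod.natCast_zmod_val, ZMod.natCast_zmod_val, modNCyclotomicCharacter_of_isComplexConjugation hc,
    modNCyclotomicCharacter_of_isComplexConjugation hc, modNCyclotomicCharacter_of_isComplexConjugation hc,
    hφ1, neg_one_mul, neg_inj] at hW
  exact hW

end Weil

/-! ## §4. Products of quadratic-valued characters are quadratic-valued -/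

/-- **A product of quadratic-valued Dirichlet characters, read at the product level, is quadratic-valued** (its value
at `x` is `χ₁(x)χ₂(x) ∈ {0, ±1}·{0, ±1}`; w3 g8's `changeLevel_mul_changeLevel_apply_natCast`). Curve-free; serves the
class-number form of the Bernoulli unit at the twisted character `ψ·χ̄_K` (w3 g7). [cite: Washington1997, Ch. 3] -/
theorem isQuadratic_changeLevel_mul_changeLevel {R : Type*} [CommRing R] {n₁ n₂ : ℕ} [NeZero n₁] [NeZero n₂]
    {χ₁ : DirichletCharacter R n₁} {χ₂ : DirichletCharacter R n₂} (h₁ : χ₁.IsQuadratic) (h₂ : χ₂.IsQuadratic) :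
    (changeLevel (dvd_mul_right n₁ n₂) χ₁ * changeLevel (dvd_mul_left n₂ n₁) χ₂ :
      DirichletCharacter R (n₁ * n₂)).IsQuadratic := by
  intro x
  have hx : (((x.val : ℕ)) : ZMod (n₁ * n₂)) = x := ZMod.natCast_zmod_val x
  rw [← hx, changeLevel_mul_changeLevel_apply_natCast]
  rcases h₁ (x.val : ZMod n₁) with h | h | h <;> rcases h₂ (x.val : ZMod n₂) with h' | h' | h' <;>
    rw [h, h'] <;> simp

end Summit.BirchSwinnertonDyer.BirchSwinnertonDyer.Theorems.EisensteinPrimesLineWeilRelation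

end
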